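import Summits.ABC.StewartYu.PadicG3TwoSchedSatN
import Summits.ABC.StewartYu.SatBoxCount
import HarnessLib

/-!
# Cell abc-stewartyu, WP-L.P(2) (crux r4 `PadicCoreTwoRat`, stmt-ABC-20504), record interface: the SKEW PRE-FAMILY `famSatN` of the
# schedule of record `schedTwoN`, its count over `𝔑`, the two named inequality packs (`GainPackTwoN`, `SmallPackTwoN`), and the
# reduction **`frameNumericsTwoRASat_schedTwoN`** of the record's obligation list to them

`Summits/ABC/StewartYu/PadicG3TwoSatPack.lean` — cell `abc-stewartyu` (HOME `run/shared/lean/pub/abc-stewartyu/`), route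
`YuMatveevShapeRat`, seat p3 (g10, WP-L.P(2) lead; design line STATUS 2026-08-27T18:43Z).  Definitions (`famSatN`; the `Prop`-structures
`GainPackTwoN`, `SmallPackTwoN`) and theorems; no named fact.  Twin of p5's `PadicG3TwoScheduleS.frameNumericsTwoR_schedTwoS` /
`PadicG3TwoLevelZeroAll.frameNumericsTwoRA_schedTwoS` on p3-g9's Sat obligation structures, and of p2's `PadicG3SatStart.satFam` /
`PadicG3SatRecord.IneqPackSat` (odd core):

* `famSatN S F P` — the SKEW PRE-FAMILY: Fel'dman degrees `ℓ ≤ L03N` × the exponent vectors `μ` of the ϑ-box `|μₖ| ≤ Dco` whose VIRTUAL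
  coordinates lie in the `N`-scaled α-box, `|(μ ᵥ* U)ⱼ| ≤ N·sN j` (Nesterenko's `𝔑 ∩ 𝔚` in ϑ-coordinates); `famSatN_subset`,
  `vbox_famSatN`, `card_famSatN_le` (`≤ cardBN`), and **`card_famSatN_ge`**: `(L03N+1)·N·∏ⱼ 2·sN j ≤ #famSatN` when `C·U = N•1`,
  `N = |det C|`, `|Cⱼₖ| ≤ (d+1)!·N` (p1's `SatBox.card_satBox_ge` transported to the `snoc` coordinates of `TwoSetup`);
* `GainPackTwoN S F P Ucol` — WHAT THE RECORD'S ARITHMETIC PROVES: (L1N) the Siegel count over `𝔑`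
  `2·2^m·(2X+1)·C(T03N 0 + d, d+1) ≤ (L03N+1)·N·∏ 2·sN j`, and the GAIN branches `Bw3N/(4·2^m)^{gain} < 1/K` of (L2₀) (level `0`,
  all nodes), (L2) (levels `1 ≤ I ≤ I*N`, all of them incl. the floored ones) and (L3) (third steps, `I < I*N`) on the closed forms of
  `schedTwoN` (`KTwoSat`, `thirdDenSat`, `thirdMSat` with the virtual denominators);
* `SmallPackTwoN S F P Ucol` — WHAT THE NEGATED BOUND PROVES (via the headline): the slab smallness `‖Λ₀‖ ≤ 2^{−(m+3)}` and the
  `‖Λ₀‖`-branches of the same three lines;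
* **`frameNumericsTwoRASat_schedTwoN`** — `GainPackTwoN → SmallPackTwoN → FrameNumericsTwoRASat (schedTwoN S F P) F (Bv3N S F P)
  (Bv3N S F P 0) Ucol P.H (L03N S F P) (famSatN S F P)` (given `C` with `C·U = N•1`, `N = |det C|`, `|Cⱼₖ| ≤ (d+1)!·N` for the count and
  `Σₖ|Uₖⱼ| ≤ Ucol j` for the basis slot): every bookkeeping field of p3-g9's obligation list discharged by construction
  (`T03N_budget` for the order lines in both regimes, `DcoR_rec`/`Bv3N_rec` for the box slots, `M₀3N`/`Bw3N`/`Amax3N` for the sizes).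

WHAT THIS IS NOT: the proofs of the packs (records: sizes/budget files and the headline), the END block, the per-datum assembly
(sequel `PadicG3TwoSatSupply`); no crux moves (A1.L not moved).

References: Yu. V. Nesterenko, LNM 1819 (2003), §3.4–§3.5 (Prop 3.4, 3.7, 3.9), §4 (4.3)–(4.5), (4.35); K. Yu, Acta Math. 211
(2013), Lemma 4.2, §5 (5.22)–(5.41), Lemmas 5.3–5.4; HOME/p1/memo/ParN-design-g10.md §0 (N2); HOME/p3/memo-12.
-/

noncomputable section

open Finset Polynomial
open scoped Matrix Nat
open Literature.NumberTheory.Transcendental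
open Literature.NumberTheory.Transcendental (FeldmanDelta.den)
open Literature.NumberTheory.Transcendental.FeldmanDelta
open Literature.NumberTheory.Transcendental.CW77 (heightProd)
open Literature.NumberTheory.Transcendental.CW77.Setup (Tau tauNorm)
open Literature.NumberTheory.Transcendental.PadicCW77 (condExp)

namespace Summit.ABC.StewartYu

namespace TwoSetup

open Summit.ABC.StewartYu.FeldmanBasis Summit.ABC.StewartYu.G3Boxes PadicG3Par

variable (S : TwoSetup) (F : S.SatData) (P : PadicG3Par (S.d + 1)) (Ucol : Fin (S.d + 1) → ℕ)

/-! ### The skew pre-family -/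

/-- **The skew pre-family** `{(ℓ, μ) : ℓ ≤ L03N, |μₖ| ≤ Dco, ∀ j |(μ ᵥ* U)ⱼ| ≤ N·sN j}` (Nesterenko's `𝔑 ∩ 𝔚` in the ϑ-coordinates of
the saturated basis, times the Fel'dman degrees). [cite: Nesterenko2003, §3.5 (𝔑 ∩ 𝔚) and (3.12); shape only] -/
def famSatN : Finset (ℕ × ((Fin S.d → ℤ) × ℤ)) :=
  (famBox (S.L03N F P) (fun _ => S.DcoR F P 0) (S.DcoR F P 0)).filter fun i =>
    ∀ j, |((Fin.snoc i.2.1 i.2.2 : Fin (S.d + 1) → ℤ) ᵥ* F.U) j| ≤ ((F.N * S.sN P j : ℕ) : ℤ)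

/-- The skew pre-family lies in the level-`0` coordinate box of the schedule. [folklore] -/
theorem famSatN_subset :
    S.famSatN F P ⊆ famBox (S.L03N F P) ((S.schedTwoN F P).Dbox 0) ((S.schedTwoN F P).Dθ 0) :=
  filter_subset _ _

/-- The skew pre-family lies in the level-`0` virtual box `Bv3N 0 = N·sN`. [folklore] -/
theorem vbox_famSatN : ∀ i ∈ S.famSatN F P, ∀ j,
    |((Fin.snoc i.2.1 i.2.2 : Fin (S.d + 1) → ℤ) ᵥ* F.U) j| ≤ (S.Bv3N F P 0 j : ℤ) := by
  intro i hi j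
  rw [Bv3N_zero]
  exact ((mem_filter.mp hi).2 j)

/-- `#famSatN ≤ cardBN` (the coordinate box count). [folklore] -/
theorem card_famSatN_le : (S.famSatN F P).card ≤ S.cardBN F P := by
  refine (card_filter_le _ _).trans ?_
  rw [card_famBox, DcoR_zero]
  unfold cardBN
  exact le_rfl

/-- **THE COUNT OF THE SKEW PRE-FAMILY OVER `𝔑`**: `(L03N+1)·N·∏ⱼ 2·sN j ≤ #famSatN` when `C·U = N•1`, `N = |det C|` and
`|Cⱼₖ| ≤ (d+1)!·N` (so that the ϑ-box `Dco = (d+1)!·N·Σ sN j` contains the `C`-image of the α-box).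
[cite: Nesterenko2003, §3.4 Prop 3.4(2), §3.5; shape only] -/
theorem card_famSatN_ge (C : Matrix (Fin (S.d + 1)) (Fin (S.d + 1)) ℤ)
    (hCU : C * F.U = (F.N : ℤ) • (1 : Matrix (Fin (S.d + 1)) (Fin (S.d + 1)) ℤ))
    (hdet : (F.N : ℤ) = |C.det|) (hC : ∀ j k, |C j k| ≤ (((S.d + 1)! : ℕ) : ℤ) * F.N) :
    (S.L03N F P + 1) * (F.N * ∏ j, (2 * S.sN P j)) ≤ (S.famSatN F P).card := by
  classical
  -- the skew family in `Fin (d+1) → ℤ` coordinates and p1's count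
  set T : Finset (Fin (S.d + 1) → ℤ) :=
    (Fintype.piFinset fun _ : Fin (S.d + 1) => Icc (-(S.Dco F P : ℤ)) (S.Dco F P)).filter
      fun μ => ∀ j, |(μ ᵥ* F.U) j| ≤ (F.N : ℤ) * S.sN P j with hT
  have hLc : ∀ k, ∑ j, (S.sN P j : ℤ) * |C j k| ≤ (S.Dco F P : ℤ) := by
    intro k
    unfold Dco
    push_cast
    rw [Finset.mul_sum]
    refine Finset.sum_le_sum fun j _ => ?_
    have h0 : (0 : ℤ) ≤ S.sN P j := by positivity
    calc (S.sN P j : ℤ) * |C j k| ≤ (S.sN P j : ℤ) * ((((S.d + 1)! : ℕ) : ℤ) * F.N) :=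
          mul_le_mul_of_nonneg_left (hC j k) h0
      _ = (((S.d + 1)! : ℕ) : ℤ) * (F.N : ℤ) * (S.sN P j : ℤ) := by ring
  have hcount := SatBox.card_satBox_ge F.N F.hN F.U C hCU (S.sN P) (fun _ => S.Dco F P) hLc
  have hdetN : C.det.natAbs = F.N := by
    have := congrArg Int.natAbs hdet
    simpa [Int.natAbs_abs] using this.symm
  rw [hdetN] at hcount
  -- inject `range (L03N+1) ×ˢ T` into `famSatN` by `(ℓ, μ) ↦ (ℓ, (init μ, μ last))`
  have hcard : ((range (S.L03N F P + 1)) ×ˢ T).card ≤ (S.famSatN F P).card := by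
    refine Finset.card_le_card_of_injOn (fun q => (q.1, (Fin.init q.2, q.2 (Fin.last S.d)))) (fun q hq => ?_) ?_
    · rw [mem_coe, mem_product, hT, mem_filter, Fintype.mem_piFinset] at hq
      obtain ⟨hℓ, hbox, hv⟩ := hq
      rw [mem_coe]
      unfold famSatN
      rw [mem_filter, mem_famBox, DcoR_zero]
      refine ⟨⟨by simpa [Nat.lt_succ_iff] using hℓ, fun j => ?_, ?_⟩, fun j => ?_⟩
      · have := hbox (Fin.castSucc j); rw [mem_Icc] at this; exact abs_le.mpr this
      · have := hbox (Fin.last S.d); rw [mem_Icc] at this; exact abs_le.mpr this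
      · dsimp only
        rw [Fin.snoc_init_self]
        push_cast
        exact hv j
    · rintro ⟨ℓ, μ⟩ _ ⟨ℓ', μ'⟩ _ h
      simp only [Prod.mk.injEq] at h
      obtain ⟨hℓ, h1, h2⟩ := h
      refine Prod.ext hℓ ?_
      show μ = μ'
      rw [← Fin.snoc_init_self μ, ← Fin.snoc_init_self μ', h1, h2]
  rw [card_product, card_range] at hcard
  exact (Nat.mul_le_mul_left _ hcount).trans hcard

/-! ### The two inequality packs -/

/-- **THE GAIN PACK of the schedule of record** (what the record's arithmetic proves): (L1N) the Siegel count over `𝔑`, and the GAIN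
branches of the level-`0` all-nodes k-steps (L2₀), of the k-steps of every level `1 ≤ I ≤ I*N` (L2), and of every third step (L3).
[cite: Nesterenko2003, Prop 3.9 (3.48), §4 (4.20)–(4.35)] [cite: Yu2013, Lemma 5.2 (5.40)–(5.41), Lemma 5.4; shape only] -/
structure GainPackTwoN : Prop where
  /-- (L1N) the Siegel count over `𝔑` -/
  count : 2 * 2 ^ P.m * ((2 * P.X + 1) * (S.T03N F P 0 + S.d).choose (S.d + 1)) ≤
    (S.L03N F P + 1) * (F.N * ∏ j, (2 * S.sN P j))
  /-- (L2₀) gain branch, level `0`, all nodes -/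
  kstep0 : ∀ k, k < S.d + 3 → ∀ x₁ : ℤ, |x₁| ≤ (S.Nsub3N P 0 (k + 1) : ℤ) → ∀ τ : Tau S.d,
    tauNorm τ + S.T3N P 0 ≤ S.T03N F P 0 - k * S.T3N P 0 →
    S.Bw3N F P / (4 * (2 : ℝ) ^ P.m) ^ gainExpA (S.schedTwoN F P) 0 k <
      1 / KTwoSat (S.schedTwoN F P) F (S.Bv3N F P) 0 x₁ τ
  /-- (L2) gain branch, levels `1 ≤ I ≤ I*N` -/
  kstep : ∀ I, 1 ≤ I → I ≤ S.Istar3N F P → ∀ k, k < S.d + 3 → ∀ x₁ : ℤ, |x₁| ≤ (S.Nsub3N P I (k + 1) : ℤ) →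
    ∀ τ : Tau S.d, tauNorm τ + S.T3N P I ≤ S.T03N F P I - k * S.T3N P I →
    S.Bw3N F P / (4 * (2 : ℝ) ^ P.m) ^ gainExp (S.schedTwoN F P) I k <
      1 / KTwoSat (S.schedTwoN F P) F (S.Bv3N F P) I x₁ τ
  /-- (L3) gain branch, third steps `I < I*N` -/
  third : ∀ I, I < S.Istar3N F P → ∀ s : ℤ, |s| ≤ (S.Nsub3N P (I + 1) 0 : ℤ) → ¬ (3 : ℤ) ∣ s →
    ∀ τ : Tau S.d, tauNorm τ < S.T03N F P (I + 1) →
    S.Bw3N F P / (4 * (2 : ℝ) ^ P.m) ^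
        ((2 * (3 ^ (S.d + 3) * S.Xs3N P I) + 1) *
          (S.T03N F P I - (S.d + 3) * S.T3N P I - S.T03N F P (I + 1))) <
      1 / (6 * (thirdDenSat (S.schedTwoN F P) F (S.Bv3N F P) Ucol I s τ : ℝ) *
        thirdMSat (S.schedTwoN F P) F (S.Bv3N F P) Ucol I s τ * heightProd S.toQ.all ^ 5) ^ (3 ^ (S.d + 1 + 1) - 1)

/-- **THE SMALLNESS PACK of the schedule of record** (what the negated bound proves through the headline): the slab smallness and
the `‖Λ₀‖`-branches of (L2₀), (L2), (L3). [cite: Yu2013, Lemma 5.2 (5.29), Lemma 5.4 (5.62); shape only] -/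
structure SmallPackTwoN : Prop where
  /-- the slab smallness -/
  slab : ‖S.Λ₀‖ ≤ ((2 : ℝ) ^ (P.m + 3))⁻¹
  /-- (L2₀) `‖Λ₀‖`-branch, level `0` -/
  kstep0 : ∀ k, k < S.d + 3 → ∀ x₁ : ℤ, |x₁| ≤ (S.Nsub3N P 0 (k + 1) : ℤ) → ∀ τ : Tau S.d,
    tauNorm τ + S.T3N P 0 ≤ S.T03N F P 0 - k * S.T3N P 0 →
    S.Bw3N F P * ‖S.Λ₀‖ * (2 : ℝ) ^ S.T3N P 0 * (2 : ℝ) ^ condExp 2 (2 * S.Nsub3N P 0 k + 1) (S.T3N P 0) <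
      1 / KTwoSat (S.schedTwoN F P) F (S.Bv3N F P) 0 x₁ τ
  /-- (L2) `‖Λ₀‖`-branch, levels `1 ≤ I ≤ I*N` -/
  kstep : ∀ I, 1 ≤ I → I ≤ S.Istar3N F P → ∀ k, k < S.d + 3 → ∀ x₁ : ℤ, |x₁| ≤ (S.Nsub3N P I (k + 1) : ℤ) →
    ∀ τ : Tau S.d, tauNorm τ + S.T3N P I ≤ S.T03N F P I - k * S.T3N P I →
    S.Bw3N F P * ‖S.Λ₀‖ * (2 : ℝ) ^ S.T3N P I * (2 : ℝ) ^ condExp 2 (2 * S.Nsub3N P I k + 1) (S.T3N P I) <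
      1 / KTwoSat (S.schedTwoN F P) F (S.Bv3N F P) I x₁ τ
  /-- (L3) `‖Λ₀‖`-branch, third steps `I < I*N` -/
  third : ∀ I, I < S.Istar3N F P → ∀ s : ℤ, |s| ≤ (S.Nsub3N P (I + 1) 0 : ℤ) → ¬ (3 : ℤ) ∣ s →
    ∀ τ : Tau S.d, tauNorm τ < S.T03N F P (I + 1) →
    S.Bw3N F P * ‖S.Λ₀‖ * (2 : ℝ) ^ (S.T03N F P I - (S.d + 3) * S.T3N P I - S.T03N F P (I + 1)) *
        (2 : ℝ) ^ condExp 2 (2 * (3 ^ (S.d + 3) * S.Xs3N P I) + 1)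
          (S.T03N F P I - (S.d + 3) * S.T3N P I - S.T03N F P (I + 1)) <
      1 / (6 * (thirdDenSat (S.schedTwoN F P) F (S.Bv3N F P) Ucol I s τ : ℝ) *
        thirdMSat (S.schedTwoN F P) F (S.Bv3N F P) Ucol I s τ * heightProd S.toQ.all ^ 5) ^ (3 ^ (S.d + 1 + 1) - 1)

variable {S F P Ucol}

/-! ### The obligation structures of the levels from the packs -/

/-- **Level-`0` all-nodes chain obligations of `schedTwoN`** from the two branches of (L2₀). [cite: Nesterenko2003, §4; shape only] -/
theorem kfinalTwoAllSat_schedTwoN (hG : S.GainPackTwoN F P Ucol) (hΛ : S.SmallPackTwoN F P Ucol) :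
    KFinalTwoAllSat (S.schedTwoN F P) F (S.Bv3N F P) 0 where
  Nsub_zero := rfl
  Nfin_le := by
    rw [schedTwoN_Nfin, schedTwoN_Nsub, schedTwoN_kst]
    unfold Nsub3N
    rw [if_neg (by omega)]
  Tfin_le := by
    rw [schedTwoN_Tfin, schedTwoN_kst, schedTwoN_tdec, schedTwoN_T0]
    have := (S.T03N_budget F P 0).1
    omega
  one_le_kst := by rw [schedTwoN_kst]; omega
  one_le_tdec := by rw [schedTwoN_tdec]; exact le_trans (by norm_num) (S.T3N_ge P 0)
  Xb_nonneg := S.Xb3N_nonneg F P 0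
  one_le_den₀ := fun _ _ => Nat.one_le_pow _ _ (Nat.lcmUpto_pos P.H)
  KTwoSat_pos := S.KTwoSat_schedTwoN_pos F P 0
  hfinal := fun k hk x₁ hx τ hτ => max_lt (hΛ.kstep0 k hk x₁ hx τ hτ) (hG.kstep0 k hk x₁ hx τ hτ)

/-- **Inner-chain obligations of `schedTwoN` at level `1 ≤ I ≤ I*N`** from the two branches of (L2).
[cite: Nesterenko2003, §4; shape only] -/
theorem kfinalTwoSat_schedTwoN (hG : S.GainPackTwoN F P Ucol) (hΛ : S.SmallPackTwoN F P Ucol)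
    {I : ℕ} (h1 : 1 ≤ I) (hI : I ≤ S.Istar3N F P) :
    KFinalTwoSat (S.schedTwoN F P) F (S.Bv3N F P) I where
  Nsub_zero := rfl
  Nfin_le := by
    rw [schedTwoN_Nfin, schedTwoN_Nsub, schedTwoN_kst]
    unfold Nsub3N
    rw [if_neg (by omega)]
  Tfin_le := by
    rw [schedTwoN_Tfin, schedTwoN_kst, schedTwoN_tdec, schedTwoN_T0]
    have := (S.T03N_budget F P I).1
    omega
  one_le_kst := by rw [schedTwoN_kst]; omega
  one_le_tdec := by rw [schedTwoN_tdec]; exact le_trans (by norm_num) (S.T3N_ge P I)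
  Xb_nonneg := S.Xb3N_nonneg F P I
  one_le_den₀ := fun _ _ => Nat.one_le_pow _ _ (Nat.lcmUpto_pos P.H)
  KTwoSat_pos := S.KTwoSat_schedTwoN_pos F P I
  hfinal := fun k hk x₁ hx τ hτ => max_lt (hΛ.kstep I h1 hI k hk x₁ hx τ hτ) (hG.kstep I h1 hI k hk x₁ hx τ hτ)

/-- **Third-step obligations of `schedTwoN` at level `I < I*N`** from the two branches of (L3) (the order lines by `T03N_budget`).
[cite: Yu2013, Lemma 5.4; shape only] -/
theorem thirdFinalTwoRSat_schedTwoN (hG : S.GainPackTwoN F P Ucol) (hΛ : S.SmallPackTwoN F P Ucol)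
    {I : ℕ} (hI : I < S.Istar3N F P) :
    ThirdFinalTwoRSat (S.schedTwoN F P) F (S.Bv3N F P) Ucol I where
  tthird_pos := by
    rw [schedTwoN_Tfin, schedTwoN_T0]
    have h1 := (S.T03N_budget F P I).1
    have h2 := (S.T03N_budget F P I).2 hI
    omega
  T0_succ_le := by
    rw [schedTwoN_Tfin, schedTwoN_T0]
    have h1 := (S.T03N_budget F P I).1
    have h2 := (S.T03N_budget F P I).2 hI
    omega
  cardB_mono := le_rfl
  Bw_mono := le_rfl
  Xb_succ := fun j => by rw [schedTwoN_Dbox, schedTwoN_Dθ, schedTwoN_Xb]; exact S.Xb3N_ge F P (I + 1) j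
  one_le_den₀ := fun _ _ => Nat.one_le_pow _ _ (Nat.lcmUpto_pos P.H)
  hfinal := fun s hs h3 τ hτ => by
    have hs' : |s| ≤ (S.Nsub3N P (I + 1) 0 : ℤ) := by rwa [schedTwoN_N0] at hs
    have hτ' : tauNorm τ < S.T03N F P (I + 1) := by rwa [schedTwoN_T0] at hτ
    rw [schedTwoN_Bw, schedTwoN_Tfin, schedTwoN_T0, schedTwoN_Nfin, schedTwoN_m]
    exact max_lt (hΛ.third I hI s hs' h3 τ hτ') (hG.third I hI s hs' h3 τ hτ')

/-! ### The obligation list from the packs -/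

/-- **THE RECORD'S OBLIGATION LIST FOR THE 𝔑-THREADED FRAME, FROM THE TWO PACKS**: with the skew pre-family `famSatN`, the virtual
schedule `Bv3N`, `Bv₀ = Bv3N 0`, `H = P.H`, `L₀ = L03N`, every field of `FrameNumericsTwoRASat (schedTwoN S F P) …` holds once the
record proves `GainPackTwoN` and the negated bound proves `SmallPackTwoN` (given the presentation's `C` for the count and the basis
slot `Σₖ|Uₖⱼ| ≤ Ucol j`). [cite: Nesterenko2003, §3.5 Prop 3.9, §4 (4.3)–(4.5), (4.35)] [cite: Yu2013, §5 (5.22); shape only] -/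
theorem frameNumericsTwoRASat_schedTwoN (C : Matrix (Fin (S.d + 1)) (Fin (S.d + 1)) ℤ)
    (hCU : C * F.U = (F.N : ℤ) • (1 : Matrix (Fin (S.d + 1)) (Fin (S.d + 1)) ℤ))
    (hdet : (F.N : ℤ) = |C.det|) (hC : ∀ j k, |C j k| ≤ (((S.d + 1)! : ℕ) : ℤ) * F.N)
    (hUcol : ∀ j, ∑ k, |F.U k j| ≤ (Ucol j : ℤ))
    (hG : S.GainPackTwoN F P Ucol) (hΛ : S.SmallPackTwoN F P Ucol) :
    FrameNumericsTwoRASat (S.schedTwoN F P) F (S.Bv3N F P) (S.Bv3N F P 0) Ucol P.H (S.L03N F P) (S.famSatN F P) := by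
  have hH : 1 ≤ P.H := le_max_left _ _
  refine
    { one_le_H := hH
      T0_pos := S.one_le_T03N F P 0
      sub := S.famSatN_subset F P
      vbox := S.vbox_famSatN F P
      Bv0_le := fun j => le_rfl
      Ucol_ge := hUcol
      count := ?_
      cardB0 := S.card_famSatN_le F P
      L_le := le_rfl
      Xb0 := ?_
      Bw0 := fun ℓ hℓ => S.Bw3N_ge F P ℓ hℓ
      den₀_eq := fun _ _ _ => rfl
      M₀_ge := fun I _ x τ ℓ hℓ => S.M₀3N_ge F P I x τ ℓ hℓ
      level0_size := ?_
      box := fun I _ => ⟨fun j => S.DcoR_rec F P I, S.DcoR_rec F P I⟩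
      vbox_succ := fun I _ j => S.Bv3N_rec F P I j
      kfinal0 := kfinalTwoAllSat_schedTwoN hG hΛ
      kfinal := fun I h1 hI => kfinalTwoSat_schedTwoN hG hΛ h1 hI
      third := fun I hI => thirdFinalTwoRSat_schedTwoN hG hΛ hI }
  · -- (L1N): `2·2^m·#eqSet ≤ 2·2^m·(2X+1)·C(T0+d, d+1) ≤ (L03N+1)·N·∏ 2sN ≤ #famSatN`
    rw [schedTwoN_m, schedTwoN_N0, schedTwoN_T0, Nsub3N_zero_zero]
    exact ((Nat.mul_le_mul_left _ (card_eqSet_le_choose S.d P.X (S.T03N F P 0))).trans hG.count).trans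
      (S.card_famSatN_ge F P C hCU hdet hC)
  · intro i hi j
    rw [schedTwoN_Xb]
    have hb := (mem_famBox.mp (S.famSatN_subset F P hi)).2
    simp only [schedTwoN_Dbox, schedTwoN_Dθ] at hb
    exact (S.abs_dirScalar_le hb.1 hb.2 j).trans (S.Xb3N_ge F P 0 j)
  · refine ⟨S.M₀E3N F P (S.one_le_T03N F P 0), S.Amax3N F P (S.one_le_T03N F P 0), ?_, S.one_le_Amax3N F P _, ?_, ?_⟩
    · intro e he
      rw [schedTwoN_M₀]
      rw [schedTwoN_N0, schedTwoN_T0, Nsub3N_zero_zero] at he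
      exact S.M₀3N_le_M₀E3N F P _ he
    · intro e he
      rw [schedTwoN_Xb]
      rw [schedTwoN_N0, schedTwoN_T0, Nsub3N_zero_zero] at he
      exact S.prod_le_Amax3N F P _ he
    · rw [schedTwoN_P]
      have hA : 0 ≤ S.Amax3N F P (S.one_le_T03N F P 0) := le_trans zero_le_one (S.one_le_Amax3N F P _)
      exact Int.ceil_le_ceil (mul_le_mul_of_nonneg_right (by exact_mod_cast S.card_famSatN_le F P) hA)

end TwoSetup

end Summit.ABC.StewartYu

end
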